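import Summits.AnomalousDissipation.AnomalousDissipation.Theorems.MarginalStabilityChainBurgersLayerLowReDecay

/-!
# Route MarginalStabilityChain · BurgersLayerLowRe — the weighted energy inequality

Helper file (supports stmt-AnomalousDissipation-3010, `BurgersLayerLowRe`). For a `C²` solution `ω` of
the Burgers-layer mode equation `σω = −ia(Uω + U₂ψ) + ω + yω' + ω'' − α²ω` in the Gaussian class
(`ω, ω', ω''` bounded by polynomials times `e^{−y²/4}`), pairing with `ω̄ e^{θy²/2}` (`0 < θ < 1`,
real inner product of `ℂ`) and integrating by parts twice on the line gives the identity

`∫ e^{θy²/2}‖ω' + θyω‖² + (θ(1−θ)/2)∫e^{θy²/2}y²‖ω‖² + (re σ + α² − (1−θ)/2)∫e^{θy²/2}‖ω‖²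
   = −a ∫ e^{θy²/2} U₂ ⟪ω, iψ⟫`

— the advection term `−iaU|ω|²` is purely imaginary and drops out — whence, for
`(1−θ)/2 ≤ re σ + α²` and `|U₂| ≤ |y|e^{−y²/2}`, `‖ψ‖ ≤ B`, the **energy inequality**
`∫ e^{θy²/2}‖ω' + θyω‖² ≤ |a| B ∫ |y|‖ω‖` (`energy_ineq`). The weight `θ < 1` (instead of the
symmetrising `θ = 1`) keeps every integral absolutely convergent in the class `|ω| ≤ Ce^{−y²/4}` at the
price `(1−θ)/2` of coercivity, paid by `α²` in the application (`θ = 1 − min(α², 1/2)`). New here; the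
underlying identity is the `L²(e^{y²/2})` energy method for the Ornstein–Uhlenbeck operator
(Gallay–Wayne 2005 App. A).
-/

noncomputable section

open MeasureTheory Set Filter Topology
open scoped Real RealInnerProductSpace Interval

namespace Summit.AnomalousDissipation.AnomalousDissipation.Theorems.MarginalStabilityChainBurgersLayerLowRe

-- the summit and its single sub-problem share the name `AnomalousDissipation` (tree layout D-0017)
set_option linter.dupNamespace false

/-! ### The weighted energy inequality -/

section Energy

/-- Pointwise algebra behind the energy identity: pairing the mode equation
`σ w = −i a (u w + u₂ v) + w + y w' + w'' − α² w` with `w` in the real inner product of `ℂ`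
kills the advection term and leaves
`re σ ‖w‖² = −(a u₂)⟪w, i v⟫ + ‖w‖² + y⟪w, w'⟫ + ⟪w, w''⟫ − α²‖w‖²`. [folklore] -/
theorem energy_pointwise {σ w w' w'' v : ℂ} {a u u₂ y al : ℝ}
    (h : σ * w = -(Complex.I * a) * ((u : ℂ) * w + (u₂ : ℂ) * v) + w + y * w' + w'' - (al : ℂ) ^ 2 * w) :
    σ.re * ‖w‖ ^ 2 = -(a * u₂) * ⟪w, Complex.I * v⟫ + ‖w‖ ^ 2 + y * ⟪w, w'⟫ + ⟪w, w''⟫ - al ^ 2 * ‖w‖ ^ 2 := by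
  have h' : σ * w = -(Complex.I * a) * ((u : ℂ) * w + (u₂ : ℂ) * v) + w + y * w' + w'' - ((al ^ 2 : ℝ) : ℂ) * w := by
    rw [h]; push_cast; ring
  have hre := congrArg Complex.re h'
  have him := congrArg Complex.im h'
  simp only [Complex.mul_re, Complex.mul_im, Complex.add_re, Complex.add_im, Complex.sub_re, Complex.sub_im,
    Complex.neg_re, Complex.neg_im, Complex.I_re, Complex.I_im, Complex.ofReal_re, Complex.ofReal_im] at hre him
  have i1 : ∀ z : ℂ, ⟪w, z⟫ = w.re * z.re + w.im * z.im := fun z => by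
    rw [Complex.inner, Complex.mul_re, Complex.conj_re, Complex.conj_im]; ring
  have n1 : ‖w‖ ^ 2 = w.re ^ 2 + w.im ^ 2 := by rw [Complex.sq_norm, Complex.normSq_apply]; ring
  simp only [i1, n1, Complex.mul_re, Complex.mul_im, Complex.I_re, Complex.I_im]
  linear_combination w.re * hre + w.im * him

/-- `‖ω' + (θy) ω‖² = ‖ω'‖² + 2θy⟪ω, ω'⟫ + θ²y²‖ω‖²` in the real inner product of `ℂ`. [folklore] -/
theorem norm_add_mul_sq (w w' : ℂ) (t : ℝ) :
    ‖w' + (t : ℂ) * w‖ ^ 2 = ‖w'‖ ^ 2 + 2 * t * ⟪w, w'⟫ + t ^ 2 * ‖w‖ ^ 2 := by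
  rw [show (t : ℂ) * w = t • w from (Complex.real_smul).symm]
  rw [norm_add_sq_real, real_inner_smul_right, real_inner_comm, norm_smul, mul_pow, Real.norm_eq_abs, sq_abs]
  ring

/-- **The weighted energy inequality.** Let `ω ∈ C²` satisfy the Burgers-layer mode equation
`σω = −i a (Uω + U₂ψ) + ω + yω' + ω'' − α²ω` with Gaussian bounds
`‖ω‖ ≤ Ce^{−y²/4}`, `‖ω'‖ ≤ (A₁ + A₂|y|)e^{−y²/4}`, `‖ω''‖ ≤ (A₃ + A₄|y| + A₅y²)e^{−y²/4}`, `‖ψ‖ ≤ B`,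
`|U₂| ≤ |y|e^{−y²/2}`. For a weight exponent `θ ∈ (0,1)` with `(1−θ)/2 ≤ re σ + α²`, pairing with
`ω̄ e^{θy²/2}` and integrating by parts twice gives
`∫ e^{θy²/2}‖ω' + θyω‖² + (θ(1−θ)/2)∫e^{θy²/2}y²‖ω‖² + (re σ + α² − (1−θ)/2)∫e^{θy²/2}‖ω‖²
   = −a ∫ e^{θy²/2} U₂ ⟪ω, iψ⟫`
(the advection term `−iaU|ω|²` is purely imaginary), whence
`∫ e^{θy²/2}‖ω' + θyω‖² ≤ |a| B ∫ |y| ‖ω‖`. [folklore] -/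
theorem energy_ineq {θ al a B C A₁ A₂ A₃ A₄ A₅ : ℝ} {σ : ℂ} {ω ω' ω'' ψ : ℝ → ℂ} {U U₂ : ℝ → ℝ}
    (hθ0 : 0 < θ) (hθ1 : θ < 1)
    (hω : ∀ y, HasDerivAt ω (ω' y) y) (hω' : ∀ y, HasDerivAt ω' (ω'' y) y) (hω''c : Continuous ω'')
    (hψc : Continuous ψ) (hU₂c : Continuous U₂)
    (hC : 0 ≤ C) (hA₁ : 0 ≤ A₁) (hA₂ : 0 ≤ A₂)
    (hωb : ∀ y, ‖ω y‖ ≤ C * Real.exp (-(y ^ 2) / 4))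
    (hω'b : ∀ y, ‖ω' y‖ ≤ (A₁ + A₂ * |y|) * Real.exp (-(y ^ 2) / 4))
    (hω''b : ∀ y, ‖ω'' y‖ ≤ (A₃ + A₄ * |y| + A₅ * y ^ 2) * Real.exp (-(y ^ 2) / 4))
    (hψb : ∀ y, ‖ψ y‖ ≤ B) (hU₂b : ∀ y, |U₂ y| ≤ |y| * Real.exp (-(y ^ 2) / 2))
    (heq : ∀ y, σ * ω y = -(Complex.I * a) * ((U y : ℂ) * ω y + (U₂ y : ℂ) * ψ y) + ω y + y * ω' y + ω'' y -
      (al : ℂ) ^ 2 * ω y)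
    (hσ : (1 - θ) / 2 ≤ σ.re + al ^ 2) :
    Integrable (fun y => Real.exp (θ * y ^ 2 / 2) * ‖ω' y + ((θ * y : ℝ) : ℂ) * ω y‖ ^ 2) ∧
      ∫ y, Real.exp (θ * y ^ 2 / 2) * ‖ω' y + ((θ * y : ℝ) : ℂ) * ω y‖ ^ 2 ≤ |a| * B * ∫ y, |y| * ‖ω y‖ := by
  -- continuity
  have hωc : Continuous ω := continuous_iff_continuousAt.2 fun y => (hω y).continuousAt
  have hω'c : Continuous ω' := continuous_iff_continuousAt.2 fun y => (hω' y).continuousAt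
  have hB : 0 ≤ B := (norm_nonneg _).trans (hψb 0)
  -- the weights
  set E : ℝ → ℝ := fun y => Real.exp (-(y ^ 2) / 4) with hE
  set ρ : ℝ → ℝ := fun y => Real.exp (θ * y ^ 2 / 2) with hρ
  set c : ℝ := (1 - θ) / 2 with hc
  have hcpos : 0 < c := by rw [hc]; linarith
  have hρpos : ∀ y, 0 < ρ y := fun y => Real.exp_pos _
  have hEpos : ∀ y, 0 < E y := fun y => Real.exp_pos _
  have hρc : Continuous ρ := by simp only [hρ]; fun_prop
  have hexp2 : ∀ y, ρ y * (E y * E y) = Real.exp (-c * y ^ 2) := fun y => by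
    simp only [hρ, hE, hc]; rw [← Real.exp_add, ← Real.exp_add]; congr 1; ring
  have hρhalf : ∀ y, Real.exp (-(y ^ 2) / 2) * ρ y ≤ 1 := fun y => by
    simp only [hρ]; rw [← Real.exp_add, Real.exp_le_one_iff]; nlinarith [sq_nonneg y]
  -- calculus of the real quantities `‖ω‖²`, `⟪ω, ω'⟫`, `⟪ω, ω''⟫`
  have hnc : Continuous fun y => ‖ω y‖ ^ 2 := by fun_prop
  have hqc : Continuous fun y => ⟪ω y, ω' y⟫ := hωc.inner hω'c
  have hpc : Continuous fun y => ⟪ω y, ω'' y⟫ := hωc.inner hω''c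
  have hnd : ∀ y, HasDerivAt (fun y => ‖ω y‖ ^ 2) (2 * ⟪ω y, ω' y⟫) y := fun y => (hω y).norm_sq
  have hqd : ∀ y, HasDerivAt (fun y => ⟪ω y, ω' y⟫) (⟪ω y, ω'' y⟫ + ‖ω' y‖ ^ 2) y := fun y => by
    have h := (hω y).inner ℝ (hω' y)
    refine h.congr_deriv ?_
    simp only [real_inner_self_eq_norm_sq]
  have hρd : ∀ y, HasDerivAt ρ (θ * y * ρ y) y := fun y => by
    have h := (((hasDerivAt_pow 2 y).const_mul θ).div_const 2).exp
    refine h.congr_deriv ?_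
    simp only [hρ, Nat.cast_ofNat]; ring
  have hyρd : ∀ y, HasDerivAt (fun u => u * ρ u) (ρ y + θ * y ^ 2 * ρ y) y := fun y => by
    have h := (hasDerivAt_id y).mul (hρd y)
    refine h.congr_deriv ?_
    simp only [id]; ring
  -- pointwise bounds
  have hqb : ∀ y, |⟪ω y, ω' y⟫| ≤ C * (A₁ + A₂ * |y|) * (E y * E y) := fun y => by
    calc |⟪ω y, ω' y⟫| ≤ ‖ω y‖ * ‖ω' y‖ := abs_real_inner_le_norm _ _
      _ ≤ (C * E y) * ((A₁ + A₂ * |y|) * E y) := by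
          gcongr
          · exact hωb y
          · exact hω'b y
      _ = C * (A₁ + A₂ * |y|) * (E y * E y) := by ring
  have hpb : ∀ y, |⟪ω y, ω'' y⟫| ≤ C * (A₃ + A₄ * |y| + A₅ * y ^ 2) * (E y * E y) := fun y => by
    calc |⟪ω y, ω'' y⟫| ≤ ‖ω y‖ * ‖ω'' y‖ := abs_real_inner_le_norm _ _
      _ ≤ (C * E y) * ((A₃ + A₄ * |y| + A₅ * y ^ 2) * E y) := by
          gcongr
          · exact hωb y
          · exact hω''b y
      _ = C * (A₃ + A₄ * |y| + A₅ * y ^ 2) * (E y * E y) := by ring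
  have hnb : ∀ y, ‖ω y‖ ^ 2 ≤ C ^ 2 * (E y * E y) := fun y => by
    have h := hωb y
    have h0 : 0 ≤ ‖ω y‖ := norm_nonneg _
    nlinarith [hEpos y]
  have hn'b : ∀ y, ‖ω' y‖ ^ 2 ≤ (A₁ ^ 2 + 2 * A₁ * A₂ * |y| + A₂ ^ 2 * y ^ 2) * (E y * E y) := fun y => by
    have h := hω'b y
    have h0 : 0 ≤ ‖ω' y‖ := norm_nonneg _
    have h1 : 0 ≤ (A₁ + A₂ * |y|) * E y := by have := hEpos y; positivity
    calc ‖ω' y‖ ^ 2 ≤ ((A₁ + A₂ * |y|) * E y) ^ 2 := by nlinarith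
      _ = (A₁ ^ 2 + 2 * A₁ * A₂ * |y| + A₂ ^ 2 * y ^ 2) * (E y * E y) := by
          have : |y| ^ 2 = y ^ 2 := sq_abs y
          linear_combination (A₂ ^ 2 * (E y * E y)) * this
  -- integrability of the nine basic integrands
  have iyρq : Integrable fun y => y * ρ y * ⟪ω y, ω' y⟫ := by
    refine integrable_of_norm_le_gauss (by fun_prop) hcpos (A := 0) (B := C * A₁) (D := C * A₂) fun y => ?_
    rw [← hexp2 y, Real.norm_eq_abs, abs_mul, abs_mul, abs_of_pos (hρpos y)]
    calc |y| * ρ y * |⟪ω y, ω' y⟫| ≤ |y| * ρ y * (C * (A₁ + A₂ * |y|) * (E y * E y)) := by gcongr; exact hqb y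
      _ = (0 + C * A₁ * |y| + C * A₂ * y ^ 2) * (ρ y * (E y * E y)) := by
          have : |y| * |y| = y ^ 2 := by rw [← sq, sq_abs]
          linear_combination (C * A₂ * ρ y * E y * E y) * this
  have iyρn : Integrable fun y => y * ρ y * ‖ω y‖ ^ 2 := by
    refine integrable_of_norm_le_gauss (by fun_prop) hcpos (A := 0) (B := C ^ 2) (D := 0) fun y => ?_
    rw [← hexp2 y, Real.norm_eq_abs, abs_mul, abs_mul, abs_of_pos (hρpos y), abs_of_nonneg (sq_nonneg ‖ω y‖)]
    calc |y| * ρ y * ‖ω y‖ ^ 2 ≤ |y| * ρ y * (C ^ 2 * (E y * E y)) := by gcongr; exact hnb y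
      _ = (0 + C ^ 2 * |y| + 0 * y ^ 2) * (ρ y * (E y * E y)) := by ring
  have iρq : Integrable fun y => ρ y * ⟪ω y, ω' y⟫ := by
    refine integrable_of_norm_le_gauss (by fun_prop) hcpos (A := C * A₁) (B := C * A₂) (D := 0) fun y => ?_
    rw [← hexp2 y, Real.norm_eq_abs, abs_mul, abs_of_pos (hρpos y)]
    calc ρ y * |⟪ω y, ω' y⟫| ≤ ρ y * (C * (A₁ + A₂ * |y|) * (E y * E y)) := by gcongr; exact hqb y
      _ = (C * A₁ + C * A₂ * |y| + 0 * y ^ 2) * (ρ y * (E y * E y)) := by ring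
  have iρn : Integrable fun y => ρ y * ‖ω y‖ ^ 2 := by
    refine integrable_of_norm_le_gauss (by fun_prop) hcpos (A := C ^ 2) (B := 0) (D := 0) fun y => ?_
    rw [← hexp2 y, Real.norm_eq_abs, abs_mul, abs_of_pos (hρpos y), abs_of_nonneg (sq_nonneg ‖ω y‖)]
    calc ρ y * ‖ω y‖ ^ 2 ≤ ρ y * (C ^ 2 * (E y * E y)) := by gcongr; exact hnb y
      _ = (C ^ 2 + 0 * |y| + 0 * y ^ 2) * (ρ y * (E y * E y)) := by ring
  have iy2ρn : Integrable fun y => y ^ 2 * ρ y * ‖ω y‖ ^ 2 := by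
    refine integrable_of_norm_le_gauss (by fun_prop) hcpos (A := 0) (B := 0) (D := C ^ 2) fun y => ?_
    rw [← hexp2 y, Real.norm_eq_abs, abs_mul, abs_mul, abs_of_pos (hρpos y), abs_of_nonneg (sq_nonneg y),
      abs_of_nonneg (sq_nonneg ‖ω y‖)]
    calc y ^ 2 * ρ y * ‖ω y‖ ^ 2 ≤ y ^ 2 * ρ y * (C ^ 2 * (E y * E y)) := by gcongr; exact hnb y
      _ = (0 + 0 * |y| + C ^ 2 * y ^ 2) * (ρ y * (E y * E y)) := by ring
  have iρp : Integrable fun y => ρ y * ⟪ω y, ω'' y⟫ := by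
    refine integrable_of_norm_le_gauss (by fun_prop) hcpos (A := C * A₃) (B := C * A₄) (D := C * A₅) fun y => ?_
    rw [← hexp2 y, Real.norm_eq_abs, abs_mul, abs_of_pos (hρpos y)]
    calc ρ y * |⟪ω y, ω'' y⟫| ≤ ρ y * (C * (A₃ + A₄ * |y| + A₅ * y ^ 2) * (E y * E y)) := by gcongr; exact hpb y
      _ = (C * A₃ + C * A₄ * |y| + C * A₅ * y ^ 2) * (ρ y * (E y * E y)) := by ring
  have iρn' : Integrable fun y => ρ y * ‖ω' y‖ ^ 2 := by
    refine integrable_of_norm_le_gauss (by fun_prop) hcpos (A := A₁ ^ 2) (B := 2 * A₁ * A₂) (D := A₂ ^ 2) fun y => ?_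
    rw [← hexp2 y, Real.norm_eq_abs, abs_mul, abs_of_pos (hρpos y), abs_of_nonneg (sq_nonneg ‖ω' y‖)]
    calc ρ y * ‖ω' y‖ ^ 2 ≤ ρ y * ((A₁ ^ 2 + 2 * A₁ * A₂ * |y| + A₂ ^ 2 * y ^ 2) * (E y * E y)) := by
          gcongr; exact hn'b y
      _ = (A₁ ^ 2 + 2 * A₁ * A₂ * |y| + A₂ ^ 2 * y ^ 2) * (ρ y * (E y * E y)) := by ring
  have hcoup_pt : ∀ y, ‖ρ y * (-(a * U₂ y) * ⟪ω y, Complex.I * ψ y⟫)‖ ≤ |a| * B * (|y| * ‖ω y‖) := fun y => by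
    rw [Real.norm_eq_abs, abs_mul, abs_mul, abs_of_pos (hρpos y), abs_neg, abs_mul]
    have h1 : |⟪ω y, Complex.I * ψ y⟫| ≤ ‖ω y‖ * B := by
      calc |⟪ω y, Complex.I * ψ y⟫| ≤ ‖ω y‖ * ‖Complex.I * ψ y‖ := abs_real_inner_le_norm _ _
        _ ≤ ‖ω y‖ * B := by gcongr; rw [norm_mul, Complex.norm_I, one_mul]; exact hψb y
    have h2 : ρ y * |U₂ y| ≤ |y| := by
      calc ρ y * |U₂ y| ≤ ρ y * (|y| * Real.exp (-(y ^ 2) / 2)) := by gcongr; exact hU₂b y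
        _ = |y| * (Real.exp (-(y ^ 2) / 2) * ρ y) := by ring
        _ ≤ |y| * 1 := by gcongr; exact hρhalf y
        _ = |y| := mul_one _
    calc ρ y * (|a| * |U₂ y| * |⟪ω y, Complex.I * ψ y⟫|) = |a| * (ρ y * |U₂ y|) * |⟪ω y, Complex.I * ψ y⟫| := by ring
      _ ≤ |a| * |y| * (‖ω y‖ * B) := by gcongr
      _ = |a| * B * (|y| * ‖ω y‖) := by ring
  have iyn : Integrable fun y => |y| * ‖ω y‖ := by
    refine integrable_of_norm_le_gauss (by fun_prop) (by norm_num : (0 : ℝ) < 1 / 4) (A := 0) (B := C) (D := 0)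
      fun y => ?_
    rw [Real.norm_eq_abs, abs_mul, abs_abs, abs_of_nonneg (norm_nonneg _), ← exp_quarter]
    calc |y| * ‖ω y‖ ≤ |y| * (C * Real.exp (-(y ^ 2) / 4)) := by gcongr; exact hωb y
      _ = (0 + C * |y| + 0 * y ^ 2) * Real.exp (-(y ^ 2) / 4) := by ring
  have icoup : Integrable fun y => ρ y * (-(a * U₂ y) * ⟪ω y, Complex.I * ψ y⟫) := by
    refine ((iyn.const_mul (|a| * B)).mono' ?_ (Eventually.of_forall hcoup_pt))
    exact (hρc.mul (((continuous_const.mul hU₂c).neg).mul (hωc.inner (continuous_const.mul hψc)))).aestronglyMeasurable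
  -- the two integrations by parts
  have ibp1 : ∫ y, (y * ρ y) * (2 * ⟪ω y, ω' y⟫) = -∫ y, (ρ y + θ * y ^ 2 * ρ y) * ‖ω y‖ ^ 2 := by
    refine integral_mul_deriv_eq_deriv_mul_of_integrable (u := fun y => y * ρ y) (v := fun y => ‖ω y‖ ^ 2)
      (u' := fun y => ρ y + θ * y ^ 2 * ρ y) (v' := fun y => 2 * ⟪ω y, ω' y⟫)
      (fun y _ => hyρd y) (fun y _ => hnd y) ?_ ?_ ?_
    · have h := iyρq.const_mul 2
      exact h.congr (Eventually.of_forall fun y => by simp only [Pi.mul_apply]; ring)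
    · have h := iρn.add (iy2ρn.const_mul θ)
      exact h.congr (Eventually.of_forall fun y => by simp only [Pi.mul_apply, Pi.add_apply]; ring)
    · exact iyρn.congr (Eventually.of_forall fun y => by simp only [Pi.mul_apply])
  have ibp2 : ∫ y, ρ y * (⟪ω y, ω'' y⟫ + ‖ω' y‖ ^ 2) = -∫ y, (θ * y * ρ y) * ⟪ω y, ω' y⟫ := by
    refine integral_mul_deriv_eq_deriv_mul_of_integrable (u := ρ) (v := fun y => ⟪ω y, ω' y⟫)
      (u' := fun y => θ * y * ρ y) (v' := fun y => ⟪ω y, ω'' y⟫ + ‖ω' y‖ ^ 2)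
      (fun y _ => hρd y) (fun y _ => hqd y) ?_ ?_ ?_
    · have h := iρp.add iρn'
      exact h.congr (Eventually.of_forall fun y => by simp only [Pi.mul_apply, Pi.add_apply]; ring)
    · have h := iyρq.const_mul θ
      exact h.congr (Eventually.of_forall fun y => by simp only [Pi.mul_apply]; ring)
    · exact iρq.congr (Eventually.of_forall fun y => by simp only [Pi.mul_apply])
  -- named integrals
  set A : ℝ := ∫ y, ρ y * ‖ω y‖ ^ 2 with hA
  set Y : ℝ := ∫ y, y ^ 2 * ρ y * ‖ω y‖ ^ 2 with hY
  set Q : ℝ := ∫ y, y * ρ y * ⟪ω y, ω' y⟫ with hQ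
  set P : ℝ := ∫ y, ρ y * ⟪ω y, ω'' y⟫ with hP
  set P' : ℝ := ∫ y, ρ y * ‖ω' y‖ ^ 2 with hP'
  set K : ℝ := ∫ y, ρ y * (-(a * U₂ y) * ⟪ω y, Complex.I * ψ y⟫) with hK
  set D : ℝ := ∫ y, ρ y * ‖ω' y + ((θ * y : ℝ) : ℂ) * ω y‖ ^ 2 with hD
  have hA0 : 0 ≤ A := integral_nonneg fun y => by have := hρpos y; positivity
  have hY0 : 0 ≤ Y := integral_nonneg fun y => by have := hρpos y; positivity
  -- IBP identities in terms of the named integrals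
  have e1 : 2 * Q = -(A + θ * Y) := by
    have h1 : ∫ y, (y * ρ y) * (2 * ⟪ω y, ω' y⟫) = 2 * Q := by
      rw [hQ, ← integral_const_mul]; congr 1; funext y; ring
    have h2 : ∫ y, (ρ y + θ * y ^ 2 * ρ y) * ‖ω y‖ ^ 2 = A + θ * Y := by
      rw [hA, hY, ← integral_const_mul, ← integral_add iρn (iy2ρn.const_mul θ)]
      congr 1; funext y; ring
    rw [← h1, ibp1, h2]
  have e2 : P + P' = -(θ * Q) := by
    have h1 : ∫ y, ρ y * (⟪ω y, ω'' y⟫ + ‖ω' y‖ ^ 2) = P + P' := by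
      rw [hP, hP', ← integral_add iρp iρn']; congr 1; funext y; ring
    have h2 : ∫ y, (θ * y * ρ y) * ⟪ω y, ω' y⟫ = θ * Q := by
      rw [hQ, ← integral_const_mul]; congr 1; funext y; ring
    rw [← h1, ibp2, h2]
  -- the expansion of `D`
  have hDexp : ∀ y, ρ y * ‖ω' y + ((θ * y : ℝ) : ℂ) * ω y‖ ^ 2 =
      ρ y * ‖ω' y‖ ^ 2 + 2 * θ * (y * ρ y * ⟪ω y, ω' y⟫) + θ ^ 2 * (y ^ 2 * ρ y * ‖ω y‖ ^ 2) := fun y => by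
    rw [norm_add_mul_sq]; ring
  have iD1 : Integrable fun y => 2 * θ * (y * ρ y * ⟪ω y, ω' y⟫) := iyρq.const_mul _
  have iD2 : Integrable fun y => θ ^ 2 * (y ^ 2 * ρ y * ‖ω y‖ ^ 2) := iy2ρn.const_mul _
  have iD3 : Integrable fun y => ρ y * ‖ω' y‖ ^ 2 + 2 * θ * (y * ρ y * ⟪ω y, ω' y⟫) := iρn'.add iD1
  have iD : Integrable fun y => ρ y * ‖ω' y + ((θ * y : ℝ) : ℂ) * ω y‖ ^ 2 :=
    (iD3.add iD2).congr (Eventually.of_forall fun y => (hDexp y).symm)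
  have e3 : D = P' + 2 * θ * Q + θ ^ 2 * Y := by
    rw [hD, hP', hQ, hY]
    simp_rw [hDexp]
    rw [integral_add iD3 iD2, integral_add iρn' iD1, integral_const_mul, integral_const_mul]
  -- the integrated mode equation
  have e4 : σ.re * A = K + A + Q + P - al ^ 2 * A := by
    have h : ∀ y, σ.re * (ρ y * ‖ω y‖ ^ 2) =
        ρ y * (-(a * U₂ y) * ⟪ω y, Complex.I * ψ y⟫) + ρ y * ‖ω y‖ ^ 2 + y * ρ y * ⟪ω y, ω' y⟫ +
          ρ y * ⟪ω y, ω'' y⟫ - al ^ 2 * (ρ y * ‖ω y‖ ^ 2) := fun y => by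
      have hp := energy_pointwise (heq y)
      calc σ.re * (ρ y * ‖ω y‖ ^ 2) = ρ y * (σ.re * ‖ω y‖ ^ 2) := by ring
        _ = ρ y * (-(a * U₂ y) * ⟪ω y, Complex.I * ψ y⟫ + ‖ω y‖ ^ 2 + y * ⟪ω y, ω' y⟫ + ⟪ω y, ω'' y⟫ -
              al ^ 2 * ‖ω y‖ ^ 2) := by rw [hp]
        _ = _ := by ring
    have hlhs : σ.re * A = ∫ y, σ.re * (ρ y * ‖ω y‖ ^ 2) := by rw [hA, integral_const_mul]
    have i1 : Integrable fun y => ρ y * (-(a * U₂ y) * ⟪ω y, Complex.I * ψ y⟫) + ρ y * ‖ω y‖ ^ 2 := icoup.add iρn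
    have i2 : Integrable fun y => ρ y * (-(a * U₂ y) * ⟪ω y, Complex.I * ψ y⟫) + ρ y * ‖ω y‖ ^ 2 +
        y * ρ y * ⟪ω y, ω' y⟫ := i1.add iyρq
    have i3 : Integrable fun y => ρ y * (-(a * U₂ y) * ⟪ω y, Complex.I * ψ y⟫) + ρ y * ‖ω y‖ ^ 2 +
        y * ρ y * ⟪ω y, ω' y⟫ + ρ y * ⟪ω y, ω'' y⟫ := i2.add iρp
    have i4 : Integrable fun y => al ^ 2 * (ρ y * ‖ω y‖ ^ 2) := iρn.const_mul _
    rw [hlhs]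
    simp_rw [h]
    rw [integral_sub i3 i4, integral_add i2 iρp, integral_add i1 iyρq, integral_add icoup iρn, integral_const_mul]
  -- the energy identity and the inequality
  have e5 : D = K - (σ.re + al ^ 2 - (1 - θ) / 2) * A - θ * (1 - θ) / 2 * Y := by
    linear_combination e3 + e2 + e4 + ((1 + θ) / 2) * e1
  have hKb : K ≤ |a| * B * ∫ y, |y| * ‖ω y‖ := by
    refine (le_abs_self K).trans ?_
    rw [hK, ← Real.norm_eq_abs, ← integral_const_mul]
    exact norm_integral_le_of_norm_le (iyn.const_mul _) (Eventually.of_forall hcoup_pt)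
  have hcoef : 0 ≤ (σ.re + al ^ 2 - (1 - θ) / 2) * A := mul_nonneg (by linarith) hA0
  have hcoef' : 0 ≤ θ * (1 - θ) / 2 * Y := mul_nonneg (by nlinarith) hY0
  refine ⟨iD, ?_⟩
  show D ≤ |a| * B * ∫ y, |y| * ‖ω y‖
  linarith

end Energy

end Summit.AnomalousDissipation.AnomalousDissipation.Theorems.MarginalStabilityChainBurgersLayerLowRe
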